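import Summits.Ventures.CertifiedArithmetic.Expansions.FastExpansionSumMergeOrder
import Summits.Ventures.CertifiedArithmetic.Expansions.Orient2dBlocks
import Mathlib.Tactic.Linarith
import Mathlib.Tactic.Positivity
import Mathlib.Tactic.Ring
import Mathlib.Tactic.NormNum

/-!
# Weakly nonoverlapping expansions, part 14: `predicates.c`'s `fast_expansion_sum_zeroelim`
# (its merge order and its on-the-fly zero elimination)

HONEST FRAMING (ENGINES group, unit `eng-quad-4`, kernels lane of the `certquad` engine — shared
numerical engines serving client cells; rigour lives in the verifiers; every published number
belongs to a client cell's ledger, not to the engines group): NEW WORK of the lane's Lean line, not a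
published result, hence under `Summits/Ventures/` with no citation tag; nothing here is cited anywhere
as a literature fact.  Overview of the development: module docstring of `WeakExpansion.lean`.

WHAT THIS FILE ADDS.  Part 13 (`FastExpansionSumMergeOrder.lean`) proved FAST-EXPANSION-SUM correct
for every ADMISSIBLE merge order (`IsMerge`, Theorem 2′ `fastExpansionSumOn_spec`).  Here the merge
actually performed by the public-domain `predicates.c` is transcribed and shown admissible, so that
the C routine inherits Theorem 2′:

* `takeE enow fnow` — the C test `(fnow > enow) == (fnow > -enow)` deciding that `enow` is taken;
  `abs_le_of_takeE` / `abs_le_of_not_takeE`: whichever head is taken does not exceed the other in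
  magnitude (on a tie `|enow| = |fnow| ≠ 0` it takes `fnow` iff `fnow > 0`; zeros are taken first).
* `mergePredicates e f` — the resulting merge; `isMerge_mergePredicates`: admissible on inputs sorted
  by magnitude except zeros; an `example` where it differs from the tree's `mergeExpansions`.
* `fastExpansionSumC` / `fastExpansionSumZeroElimC` — `predicates.c`'s routine (its merge, Lines 2–5,
  zero elimination) and `fastExpansionSumZeroElimC_spec`: the specification of
  `fastExpansionSumZeroElim_spec` (W-expansions of floats in; a NONEMPTY W-expansion of floats out,
  exact sum, zero-free or `⟨0⟩`, length `≤ max (m + n) 1`; `p ≥ 4`, `RoundoffBelow 2`).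
  (`predicates.c` uses `Fast_Two_Sum` for the second component when both inputs still have
  components pending and `Two_Sum` otherwise; by `fastExpansionSumOn_eq_growExpansion` both give the
  list `fastExpansionSumOn` computes.)
* `onlineZeroElim` / `zeroElim_eq_online` — eliminating zeros ON THE FLY as the C code does (store
  only nonzero `hh`, then `if ((Q != 0.0) || (hindex == 0)) h[hindex++] = Q`) stores exactly
  `zeroElim` of the full output list "the `hh`s, then `Q`" (`growExpansion_eq_dropLast_append`), so
  modelling zero elimination as a post-pass changes nothing.

EVIDENCE (informal, exact rational model; evidence only): see part 13 — on 3000 random tie-heavy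
pairs per precision `p = 6 / 8 / 11 / 24` the transcribed merge was admissible every time and its
outputs weakly nonoverlapping with the exact sum; ORIENT2D's exact stage run with this routine and
with the tree's on 1000 random / near-degenerate inputs per precision gave identical `D` throughout.
-/

namespace Summit.Ventures.CertifiedArithmetic.Expansions

open Literature.ComputerArithmetic.JeannerodRump2018
open Literature.ComputerArithmetic.BoldoJeannerodMelquiondMuller2023 hiding twoSum twoSum_fst isFloat_twoSum
open Literature.ComputerArithmetic.Shewchuk1997

variable {p : ℕ} {emin : ℤ} {fl : ℚ → ℚ}

/-! ## The merge of `predicates.c` -/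

/-- `predicates.c`'s comparison: with `enow`, `fnow` the pending heads, it takes `enow` iff
`(fnow > enow) == (fnow > -enow)`. -/
def takeE (enow fnow : ℚ) : Bool :=
  decide (enow < fnow) == decide (-enow < fnow)

/-- The test as a biconditional. -/
theorem takeE_eq_true_iff (x y : ℚ) : takeE x y = true ↔ (x < y ↔ -x < y) := by
  unfold takeE
  rw [beq_iff_eq, decide_eq_decide]

/-- If the test takes `enow`, then `|enow| ≤ |fnow|`. -/
theorem abs_le_of_takeE {x y : ℚ} (h : takeE x y = true) : |x| ≤ |y| := by
  have hiff : x < y ↔ -x < y := (takeE_eq_true_iff x y).mp h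
  by_contra hlt
  push Not at hlt
  rcases lt_trichotomy x 0 with hx | rfl | hx
  · rw [abs_of_neg hx] at hlt
    obtain ⟨h1, h2⟩ := abs_lt.mp hlt
    have hxy : x < y := by linarith
    have hnxy : ¬ (-x < y) := not_lt.mpr h2.le
    exact hnxy (hiff.mp hxy)
  · rw [abs_zero] at hlt
    exact absurd hlt (not_lt.mpr (abs_nonneg y))
  · rw [abs_of_pos hx] at hlt
    obtain ⟨h1, h2⟩ := abs_lt.mp hlt
    have hnxy : ¬ (x < y) := not_lt.mpr h2.le
    exact hnxy (hiff.mpr h1)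

/-- If the test takes `fnow`, then `|fnow| ≤ |enow|`. -/
theorem abs_le_of_not_takeE {x y : ℚ} (h : takeE x y = false) : |y| ≤ |x| := by
  have hniff : ¬ (x < y ↔ -x < y) := fun hiff => by
    have := (takeE_eq_true_iff x y).mpr hiff
    rw [h] at this
    exact Bool.false_ne_true this
  by_contra hlt
  push Not at hlt
  apply hniff
  rcases lt_trichotomy y 0 with hy | rfl | hy
  · rw [abs_of_neg hy] at hlt
    obtain ⟨h1, h2⟩ := abs_lt.mp hlt
    exact ⟨fun hxy => by linarith, fun hxy => by linarith⟩
  · rw [abs_zero] at hlt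
    exact absurd hlt (not_lt.mpr (abs_nonneg x))
  · rw [abs_of_pos hy] at hlt
    obtain ⟨h1, h2⟩ := abs_lt.mp hlt
    exact ⟨fun _ => by linarith, fun _ => h2⟩

/-- **The merge performed by `predicates.c`'s `fast_expansion_sum[_zeroelim]`**: repeatedly take
`enow` if `takeE enow fnow`, else `fnow`; when one input is exhausted, append the rest of the other. -/
def mergePredicates : List ℚ → List ℚ → List ℚ
  | [], f => f
  | x :: xs, [] => x :: xs
  | x :: xs, y :: ys =>
    if takeE x y then x :: mergePredicates xs (y :: ys) else y :: mergePredicates (x :: xs) ys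
termination_by e f => e.length + f.length

/-- Merging with an exhausted `e` returns `f`. -/
@[simp] theorem mergePredicates_nil_left (f : List ℚ) : mergePredicates [] f = f := by
  simp [mergePredicates]

/-- Merging with an exhausted `f` returns `e`. -/
@[simp] theorem mergePredicates_nil_right (e : List ℚ) : mergePredicates e [] = e := by
  cases e <;> simp [mergePredicates]

/-- The merge step while both lists have components pending: the C test `takeE` decides. -/
theorem mergePredicates_cons_cons (x y : ℚ) (xs ys : List ℚ) :
    mergePredicates (x :: xs) (y :: ys) =
      if takeE x y then x :: mergePredicates xs (y :: ys) else y :: mergePredicates (x :: xs) ys := by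
  simp [mergePredicates]

/-- `predicates.c`'s merge is admissible on inputs sorted by magnitude except zeros. -/
theorem isMerge_mergePredicates {e f : List ℚ}
    (he : e.Pairwise fun a b => b ≠ 0 → |a| ≤ |b|) (hf : f.Pairwise fun a b => b ≠ 0 → |a| ≤ |b|) :
    IsMerge (mergePredicates e f) e f := by
  induction e generalizing f with
  | nil => rw [mergePredicates_nil_left]; exact isMerge_nil_left f
  | cons x xs ihe =>
    induction f with
    | nil => rw [mergePredicates_nil_right]; exact isMerge_nil_right _
    | cons y ys ihf =>
      rw [mergePredicates_cons_cons]
      cases hxy : takeE x y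
      · rw [if_neg (by simp)]
        have hyx := abs_le_of_not_takeE hxy
        refine IsMerge.right (fun w hw hw0 => ?_) (ihf (List.pairwise_cons.mp hf).2)
        rcases List.mem_cons.mp hw with rfl | hw
        · exact hyx
        · exact hyx.trans ((List.pairwise_cons.mp he).1 w hw hw0)
      · rw [if_pos rfl]
        have hxy' := abs_le_of_takeE hxy
        refine IsMerge.left (fun w hw hw0 => ?_) (ihe (List.pairwise_cons.mp he).2 hf)
        rcases List.mem_cons.mp hw with rfl | hw
        · exact hxy'
        · exact hxy'.trans ((List.pairwise_cons.mp hf).1 w hw hw0)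

/-- The two merges genuinely differ on ties: for `e = ⟨-1⟩`, `f = ⟨1⟩` the tree puts `-1` first,
`predicates.c` puts `1` first. -/
example : mergeExpansions [-1] [1] = [-1, 1] ∧ mergePredicates [-1] [1] = [1, -1] := by
  refine ⟨?_, ?_⟩
  · rw [mergeExpansions_cons_cons]; norm_num
  · rw [mergePredicates_cons_cons]; simp [takeE]

/-! ## `predicates.c`'s `fast_expansion_sum_zeroelim` -/

/-- `predicates.c`'s FAST-EXPANSION-SUM before zero elimination: its merge, then Lines 2–5. -/
def fastExpansionSumC (fl : ℚ → ℚ) (e f : List ℚ) : List ℚ :=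
  fastExpansionSumOn fl (mergePredicates e f)

/-- `predicates.c`'s `fast_expansion_sum_zeroelim`: the same followed by zero elimination. -/
def fastExpansionSumZeroElimC (fl : ℚ → ℚ) (e f : List ℚ) : List ℚ :=
  zeroElim (fastExpansionSumC fl e f)

/-- Theorem 2′ for `predicates.c`'s merge order. -/
theorem fastExpansionSumC_spec (hp : 4 ≤ p) (hfl : IsRoundNearest p emin fl)
    (hfl2 : RoundoffBelow 2 fl) {e f : List ℚ}
    (heF : ∀ x ∈ e, IsFloat p emin x) (hes : IsWeakExpansion e)
    (hfF : ∀ x ∈ f, IsFloat p emin x) (hfs : IsWeakExpansion f) :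
    IsWeakExpansion (fastExpansionSumC fl e f) ∧ (fastExpansionSumC fl e f).sum = e.sum + f.sum ∧
      (fastExpansionSumC fl e f).length = e.length + f.length ∧
      ∀ x ∈ fastExpansionSumC fl e f, IsFloat p emin x :=
  fastExpansionSumOn_spec hp hfl hfl2 heF hes hfF hfs
    (isMerge_mergePredicates hes.pairwise_abs_le hfs.pairwise_abs_le)

/-- `predicates.c`'s `fast_expansion_sum_zeroelim` has the specification of
`fastExpansionSumZeroElim_spec`: W-expansions of floats in, a NONEMPTY W-expansion of floats out,
exact sum, zero-free or `⟨0⟩`, length `≤ max (m + n) 1` (`p ≥ 4`, `RoundoffBelow 2` rounding). -/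
theorem fastExpansionSumZeroElimC_spec (hp : 4 ≤ p) (hfl : IsRoundNearest p emin fl)
    (hfl2 : RoundoffBelow 2 fl) {e f : List ℚ}
    (heF : ∀ x ∈ e, IsFloat p emin x) (hes : IsWeakExpansion e)
    (hfF : ∀ x ∈ f, IsFloat p emin x) (hfs : IsWeakExpansion f) :
    IsWeakExpansion (fastExpansionSumZeroElimC fl e f) ∧
      (fastExpansionSumZeroElimC fl e f).sum = e.sum + f.sum ∧
      (∀ x ∈ fastExpansionSumZeroElimC fl e f, IsFloat p emin x) ∧
      fastExpansionSumZeroElimC fl e f ≠ [] ∧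
      ((∀ x ∈ fastExpansionSumZeroElimC fl e f, x ≠ 0) ∨ fastExpansionSumZeroElimC fl e f = [0]) ∧
      (fastExpansionSumZeroElimC fl e f).length ≤ max (e.length + f.length) 1 := by
  obtain ⟨hW, hS, hL, hF⟩ := fastExpansionSumC_spec hp hfl hfl2 heF hes hfF hfs
  unfold fastExpansionSumZeroElimC
  refine ⟨isWeakExpansion_zeroElim hW, by rw [sum_zeroElim, hS], fun x hx => ?_, zeroElim_ne_nil _,
    zeroElim_nonzero_or _, by rw [← hL]; exact length_zeroElim_le _⟩
  rcases mem_zeroElim hx with ⟨hx, -⟩ | rfl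
  · exact hF x hx
  · exact isFloat_zero p emin

/-- Zero elimination ON THE FLY, as `predicates.c` performs it: of the outputs `hh` only the
nonzero ones are stored, and the final accumulator `Q` is stored `if ((Q != 0.0) || (hindex == 0))`.
-/
def onlineZeroElim (hs : List ℚ) (Q : ℚ) : List ℚ :=
  if Q ≠ 0 ∨ hs.filter (· ≠ 0) = [] then hs.filter (· ≠ 0) ++ [Q] else hs.filter (· ≠ 0)

/-- Eliminating zeros on the fly stores exactly `zeroElim` of the full output list `hs ++ [Q]`
(so modelling zero elimination as a post-pass, as this development does, changes nothing). -/
theorem zeroElim_eq_online (hs : List ℚ) (Q : ℚ) : zeroElim (hs ++ [Q]) = onlineZeroElim hs Q := by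
  unfold zeroElim onlineZeroElim
  by_cases hQ : Q = 0
  · subst hQ
    have hfil : (hs ++ [(0 : ℚ)]).filter (· ≠ 0) = hs.filter (· ≠ 0) := by simp
    rw [hfil]
    by_cases hnz : hs.filter (· ≠ 0) = []
    · rw [if_pos hnz, if_pos (Or.inr hnz), hnz, List.nil_append]
    · rw [if_neg hnz, if_neg (not_or.mpr ⟨fun h => h rfl, hnz⟩)]
  · have hfil : (hs ++ [Q]).filter (· ≠ 0) = hs.filter (· ≠ 0) ++ [Q] := by simp [hQ]
    rw [hfil, if_neg (by simp), if_pos (Or.inl hQ)]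

/-- The full output list of Lines 2–5 is "the `hh`s, then `Q`": for `g = g₁ :: gs` it is
GROW-EXPANSION's output, whose last component is the final accumulator
(`getLast_growExpansion`). -/
theorem growExpansion_eq_dropLast_append (fl : ℚ → ℚ) (gs : List ℚ) (Q : ℚ) :
    growExpansion fl gs Q = (growExpansion fl gs Q).dropLast ++
      [(growExpansion fl gs Q).getLast (growExpansion_ne_nil fl gs Q)] :=
  (List.dropLast_append_getLast _).symm

end Summit.Ventures.CertifiedArithmetic.Expansions
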